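import Summits.QuantumFields.YangMills.Theorems.BalabanUVNodesN07AliasSumMargin
import HarnessLib

/-!
# DAG node N07 (road R0′ at the record; the `hker` ∕ `hpos` letter) — THE EXPLICIT ONE-LEVEL MARGIN, part 3 (adapter):
# the margin «`K₀ ≤ π^{|J|}·K`» in the RAW letters of `…OneLevelSymbol.signed_alias_sum_pos` (dag-n07-w5's `hDisp` socket)

Width seat `pub-ymgap-dag-n07-w7` (g4), `--supports stmt-QuantumFields-27364 --as helper`; count-neutral; 0 `def`.

WHY.  dag-n07-w5 g2's `…N07PointFeasibilityOneLevelForms` (p625080) ∕ `…OneLevelSymbolBridge` transfer a DISPLAYED symbol margin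
`hDisp` to the x-space forms at one averaging level; `hDisp` is written in the letters of `…OneLevelSymbol.signed_alias_sum_pos`:
per coordinate the factor `f(θ,m) = sin((θ + 2πm)∕2) ∕ (n · sin((θ + 2πm)∕(2n)))` and the denominator `Σ_κ Sxir n (θ_κ + 2πm_κ)`
(`B4Strip.Sxir n x = 4n² sin²(x∕(2n))`).  THIS FILE rewrites part 2's `matchedSymbol_le_aliasSymbolK` («`K₀(θ) ≤ π^{|J|} K(θ)`») in
exactly those letters: ★★ `displayMargin_signedLetters` (product of squares), `displayMargin_signedLetters'` (square of the product),
the dimension-uniform `displayMargin_signedLetters_of_card_le` (constant `(π^d)⁻¹` for `|J| ≤ d`), and ★★ `displayMargin_hDisp` =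
dag-n07-w5 g2's `hDisp` binder LETTER FOR LETTER (`J : Type`, `[Nonempty J]`, constant `π⁻¹ ^ |J|`; cell bus 2026-08-28 10:58Z).  Bookkeeping only:
`sin((θ+2πm)∕2) = (−1)^m sin(θ∕2)` (`Real.sin_add_nat_mul_pi`) and `Sxir_eq`, as in `signed_alias_sum_pos`.

HONEST SCOPE.  Elementary bookkeeping ([folklore]); nothing of [B11]∕[B6]∕[3] is asserted; (L2)∕(L4)∕`(P)_D` stay OPEN; the sharp
constant `1` is located numerics, not claimed; `hker`, stub 1, K0⁷∕K1⁹ NOT closed; N07 not discharged; nothing continuum ∕ OS ∕ mass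
gap ∕ Clay.  Context: [Balaban1984PropagatorsI] (1.33) p.23 (`Σ_l |u|²∕Δ²`), [Balaban1987RG1] (0.4) p.253 — nothing cited as a hypothesis.
-/

set_option autoImplicit false

noncomputable section

open Finset

namespace Summit.QuantumFields.YangMills.Theorems.N07AliasSumMargin

open Literature.MathematicalPhysics.QuantumFieldTheory.Balaban1983to89

/-! ## §6  The margin in the signed ∕ `Sxir` letters -/

/-- The centred numerator in the signed letters: `sin((θ + 2πm)∕2) = (−1)^m · sin(θ∕2)`. [folklore] -/
theorem sin_half_alias (θ : ℝ) (m : ℕ) :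
    Real.sin ((θ + 2 * Real.pi * m) / 2) = (-1 : ℝ) ^ m * Real.sin (θ / 2) := by
  have e : (θ + 2 * Real.pi * m) / 2 = θ / 2 + m * Real.pi := by ring
  rw [e, Real.sin_add_nat_mul_pi]

/-- Termwise, the CENTRE summand in the signed letters is `n⁻⁴ · L^{−|J|} ×` the summand of `aliasSymbolK_pos`'s display
(with `L = n`). [folklore] -/
theorem centreSummand_signedLetters {J : Type*} [Fintype J] {n : ℕ} (θ : J → ℝ) (m : J → Fin n) :
    (∏ κ, Real.sin ((θ κ + 2 * Real.pi * (m κ : ℕ)) / 2) /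
        ((n : ℝ) * Real.sin ((θ κ + 2 * Real.pi * (m κ : ℕ)) / (2 * n)))) /
        (∑ κ, B4Strip.Sxir n (θ κ + 2 * Real.pi * (m κ : ℕ))) ^ 2
      = ((n : ℝ) ^ 4)⁻¹ * (((n : ℝ) ^ Fintype.card J)⁻¹ *
          ((∏ κ, (-1 : ℝ) ^ (m κ : ℕ) * Real.sin (θ κ / 2) / Real.sin ((θ κ + 2 * Real.pi * (m κ : ℕ)) / (2 * n))) /
            (4 * ∑ κ, Real.sin ((θ κ + 2 * Real.pi * (m κ : ℕ)) / (2 * n)) ^ 2) ^ 2)) := by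
  simp_rw [sin_half_alias, B4Strip.Sxir_eq]
  have hden : ∏ x, (n : ℝ) * Real.sin ((θ x + 2 * Real.pi * (m x : ℕ)) / (2 * n))
      = (n : ℝ) ^ Fintype.card J * ∏ x, Real.sin ((θ x + 2 * Real.pi * (m x : ℕ)) / (2 * n)) := by
    rw [Finset.prod_mul_distrib, Finset.prod_const, Finset.card_univ]
  rw [Finset.prod_div_distrib, Finset.prod_div_distrib, hden, ← Finset.mul_sum]
  ring

/-- Termwise, the MATCHED summand in the signed letters (product of squares) is `n⁻⁴ · L^{−2|J|} ×` the summand of the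
matched display of `matchedSymbol_le_aliasSymbolK` (with `L = n`). [folklore] -/
theorem matchedSummand_signedLetters {J : Type*} [Fintype J] {n : ℕ} (θ : J → ℝ) (m : J → Fin n) :
    (∏ κ, (Real.sin ((θ κ + 2 * Real.pi * (m κ : ℕ)) / 2) /
        ((n : ℝ) * Real.sin ((θ κ + 2 * Real.pi * (m κ : ℕ)) / (2 * n)))) ^ 2) /
        (∑ κ, B4Strip.Sxir n (θ κ + 2 * Real.pi * (m κ : ℕ))) ^ 2
      = ((n : ℝ) ^ 4)⁻¹ * (((n : ℝ) ^ (2 * Fintype.card J))⁻¹ *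
          ((∏ κ, Real.sin (θ κ / 2) ^ 2 / Real.sin ((θ κ + 2 * Real.pi * (m κ : ℕ)) / (2 * n)) ^ 2) /
            (4 * ∑ κ, Real.sin ((θ κ + 2 * Real.pi * (m κ : ℕ)) / (2 * n)) ^ 2) ^ 2)) := by
  simp_rw [sin_half_alias, B4Strip.Sxir_eq]
  have hsq : ∀ κ, ((-1 : ℝ) ^ (m κ : ℕ) * Real.sin (θ κ / 2) /
      ((n : ℝ) * Real.sin ((θ κ + 2 * Real.pi * (m κ : ℕ)) / (2 * n)))) ^ 2
      = (Real.sin (θ κ / 2) ^ 2 / Real.sin ((θ κ + 2 * Real.pi * (m κ : ℕ)) / (2 * n)) ^ 2) * ((n : ℝ) ^ 2)⁻¹ := by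
    intro κ
    have h1 : ((-1 : ℝ) ^ (m κ : ℕ)) ^ 2 = 1 := by
      rw [← pow_mul, mul_comm, pow_mul, neg_one_sq, one_pow]
    rw [div_pow, mul_pow, mul_pow, h1]
    ring
  simp_rw [hsq]
  rw [Finset.prod_mul_distrib, Finset.prod_const, Finset.card_univ, ← Finset.mul_sum, inv_pow, ← pow_mul,
    mul_comm 2 (Fintype.card J)]
  ring

/-- ★★ **The display margin in the RAW letters of `signed_alias_sum_pos` (product of squares).**  For a finite `J`, odd
`n ≥ 3` and `θ ∈ (0,2π)^J`:
`(π^{|J|})⁻¹ · Σ_{m : J → Fin n} (Π_κ f(θ_κ,m_κ)²) ∕ (Σ_κ Sxir n (θ_κ + 2πm_κ))² ≤ Σ_m (Π_κ f(θ_κ,m_κ)) ∕ (Σ_κ Sxir n (θ_κ + 2πm_κ))²`,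
`f(θ,m) = sin((θ+2πm)∕2)∕(n sin((θ+2πm)∕(2n)))` — `matchedSymbol_le_aliasSymbolK` after the termwise conversions. [folklore] -/
theorem displayMargin_signedLetters {J : Type*} [Fintype J] [DecidableEq J] {n : ℕ} (hn : Odd n) (h3 : 3 ≤ n)
    (θ : J → ℝ) (hθ : ∀ κ, 0 < θ κ ∧ θ κ < 2 * Real.pi) :
    (Real.pi ^ Fintype.card J)⁻¹ * ∑ m : J → Fin n,
        (∏ κ, (Real.sin ((θ κ + 2 * Real.pi * (m κ : ℕ)) / 2) /
          ((n : ℝ) * Real.sin ((θ κ + 2 * Real.pi * (m κ : ℕ)) / (2 * n)))) ^ 2) /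
          (∑ κ, B4Strip.Sxir n (θ κ + 2 * Real.pi * (m κ : ℕ))) ^ 2
      ≤ ∑ m : J → Fin n, (∏ κ, Real.sin ((θ κ + 2 * Real.pi * (m κ : ℕ)) / 2) /
          ((n : ℝ) * Real.sin ((θ κ + 2 * Real.pi * (m κ : ℕ)) / (2 * n)))) /
          (∑ κ, B4Strip.Sxir n (θ κ + 2 * Real.pi * (m κ : ℕ))) ^ 2 := by
  have hn0 : (0 : ℝ) < n := by exact_mod_cast (show 0 < n by omega)
  have hπ : 0 < Real.pi ^ Fintype.card J := pow_pos Real.pi_pos _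
  simp_rw [centreSummand_signedLetters, matchedSummand_signedLetters, ← Finset.mul_sum]
  have h := matchedSymbol_le_aliasSymbolK hn h3 θ hθ
  -- `(π^J)⁻¹ · n⁻⁴ · K₀ ≤ n⁻⁴ · K`
  rw [← mul_assoc, mul_comm ((Real.pi ^ Fintype.card J)⁻¹), mul_assoc]
  refine mul_le_mul_of_nonneg_left ?_ (by positivity)
  rw [inv_mul_le_iff₀ hπ]
  exact h

/-- The same display margin with the SQUARE OF THE PRODUCT on the matched side (`Finset.prod_pow`). [folklore] -/
theorem displayMargin_signedLetters' {J : Type*} [Fintype J] [DecidableEq J] {n : ℕ} (hn : Odd n) (h3 : 3 ≤ n)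
    (θ : J → ℝ) (hθ : ∀ κ, 0 < θ κ ∧ θ κ < 2 * Real.pi) :
    (Real.pi ^ Fintype.card J)⁻¹ * ∑ m : J → Fin n,
        (∏ κ, Real.sin ((θ κ + 2 * Real.pi * (m κ : ℕ)) / 2) /
          ((n : ℝ) * Real.sin ((θ κ + 2 * Real.pi * (m κ : ℕ)) / (2 * n)))) ^ 2 /
          (∑ κ, B4Strip.Sxir n (θ κ + 2 * Real.pi * (m κ : ℕ))) ^ 2
      ≤ ∑ m : J → Fin n, (∏ κ, Real.sin ((θ κ + 2 * Real.pi * (m κ : ℕ)) / 2) /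
          ((n : ℝ) * Real.sin ((θ κ + 2 * Real.pi * (m κ : ℕ)) / (2 * n)))) /
          (∑ κ, B4Strip.Sxir n (θ κ + 2 * Real.pi * (m κ : ℕ))) ^ 2 := by
  simp_rw [← Finset.prod_pow]
  exact displayMargin_signedLetters hn h3 θ hθ

/-- The display margin with the DIMENSION-uniform constant `(π^d)⁻¹` for `|J| ≤ d` (the matched side is non-negative, so the
constant may be lowered; no `Nonempty J` needed). [folklore] -/
theorem displayMargin_signedLetters_of_card_le {J : Type*} [Fintype J] [DecidableEq J] {n : ℕ}
    (hn : Odd n) (h3 : 3 ≤ n) (θ : J → ℝ) (hθ : ∀ κ, 0 < θ κ ∧ θ κ < 2 * Real.pi) {d : ℕ}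
    (hJ : Fintype.card J ≤ d) :
    (Real.pi ^ d)⁻¹ * ∑ m : J → Fin n,
        (∏ κ, (Real.sin ((θ κ + 2 * Real.pi * (m κ : ℕ)) / 2) /
          ((n : ℝ) * Real.sin ((θ κ + 2 * Real.pi * (m κ : ℕ)) / (2 * n)))) ^ 2) /
          (∑ κ, B4Strip.Sxir n (θ κ + 2 * Real.pi * (m κ : ℕ))) ^ 2
      ≤ ∑ m : J → Fin n, (∏ κ, Real.sin ((θ κ + 2 * Real.pi * (m κ : ℕ)) / 2) /
          ((n : ℝ) * Real.sin ((θ κ + 2 * Real.pi * (m κ : ℕ)) / (2 * n)))) /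
          (∑ κ, B4Strip.Sxir n (θ κ + 2 * Real.pi * (m κ : ℕ))) ^ 2 := by
  have h := displayMargin_signedLetters hn h3 θ hθ
  have hB : 0 ≤ ∑ m : J → Fin n,
      (∏ κ, (Real.sin ((θ κ + 2 * Real.pi * (m κ : ℕ)) / 2) /
        ((n : ℝ) * Real.sin ((θ κ + 2 * Real.pi * (m κ : ℕ)) / (2 * n)))) ^ 2) /
        (∑ κ, B4Strip.Sxir n (θ κ + 2 * Real.pi * (m κ : ℕ))) ^ 2 :=
    Finset.sum_nonneg (fun m _ => div_nonneg (Finset.prod_nonneg (fun κ _ => sq_nonneg _)) (sq_nonneg _))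
  have hπ : (Real.pi ^ d)⁻¹ ≤ (Real.pi ^ Fintype.card J)⁻¹ :=
    (inv_le_inv₀ (pow_pos Real.pi_pos _) (pow_pos Real.pi_pos _)).mpr
      (pow_le_pow_right₀ (by linarith [Real.pi_gt_three]) hJ)
  exact (mul_le_mul_of_nonneg_right hπ hB).trans h

/-- ★★ **dag-n07-w5's `hDisp` socket, letter for letter** (`…OneLevelSymbolBridge.symbolMargin_of_display`, p626779): for every
non-empty finite `J : Type`, `θ ∈ (0,2π)^J` and odd `n ≥ 3`,
`c₁ ^ |J| · Σ_m (Π_κ f(θ_κ,m_κ)²) ∕ (Σ_κ Sxir n (θ_κ+2πm_κ))² ≤ Σ_m (Π_κ f(θ_κ,m_κ)) ∕ (Σ_κ Sxir n (θ_κ+2πm_κ))²` at `c₁ = π⁻¹`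
(`displayMargin_signedLetters` + `inv_pow`). [folklore] -/
theorem displayMargin_hDisp {n : ℕ} (hn : Odd n) (h3 : 3 ≤ n) :
    ∀ (J : Type) [Fintype J] [DecidableEq J] [Nonempty J] (θ : J → ℝ),
      (∀ κ, 0 < θ κ ∧ θ κ < 2 * Real.pi) →
      Real.pi⁻¹ ^ Fintype.card J * ∑ m : J → Fin n,
          (∏ κ, (Real.sin ((θ κ + 2 * Real.pi * (m κ : ℕ)) / 2) /
            ((n : ℝ) * Real.sin ((θ κ + 2 * Real.pi * (m κ : ℕ)) / (2 * n)))) ^ 2) /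
            (∑ κ, B4Strip.Sxir n (θ κ + 2 * Real.pi * (m κ : ℕ))) ^ 2
        ≤ ∑ m : J → Fin n, (∏ κ, Real.sin ((θ κ + 2 * Real.pi * (m κ : ℕ)) / 2) /
            ((n : ℝ) * Real.sin ((θ κ + 2 * Real.pi * (m κ : ℕ)) / (2 * n)))) /
            (∑ κ, B4Strip.Sxir n (θ κ + 2 * Real.pi * (m κ : ℕ))) ^ 2 := by
  intro J _ _ _ θ hθ
  rw [inv_pow]
  exact displayMargin_signedLetters hn h3 θ hθ


end Summit.QuantumFields.YangMills.Theorems.N07AliasSumMargin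

end
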